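import Summits.QuantumFields.BalabanUV.T4Continuum.Support.ScalarCovariantCoercive

/-!
# T⁴ programme, SUBSTRATE (shared lattice-gauge analysis library) — COMBES–THOMAS ROW DEFECTS OF THE COVARIANT SCALAR AVERAGED
# OPERATOR `S_U` FOR A SITE WEIGHT, UNIFORM IN THE LEVEL `n = L^j`: `defect(S_U) ≤ Jcov = card o·(d(1+α)κ²e^{κ²/2} + a′(1+τ)²(cosh κ − 1))`
# (file 2 of the chain `ScalarCovariantCoercive` → `ScalarCovariantCTDefects` → `ScalarCovariantGreenDecay`)

Substrate cell `b2b-balaban-substrate-*` (seat p3: covariant Laplacian ∕ Green decay constants), chain «level-free decay of the covariant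
scalar averaged Green function» = `ScalarCovariantCoercive` (file 1) → `ScalarCovariantCTDefects` (file 2) → `ScalarCovariantGreenDecay`
(file 3).  The NE rows consume the off-diagonal decay of Bałaban's background-field propagators as a LOCATED HYPOTHESIS
([Balaban1985BackgroundPropagators] = [B9] Thm 3.1 (3.42) p.397 «|(G′(U)λ)(x)| ≤ B₀(L^jη)²e^{−δ₀d(y,y′)}|λ| … δ₀, B₀ depending on d and L
only»; Thm 3.15 (3.187) p.432; rows NE2-P3 (P1-ii), NE1′-P2 WALL E-1, NE3 `hT31`), and the tree's covariant Combes–Thomas certificate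
`Literature.….B9Thm37GlueTorusCovCT` (pv21, comb model) is NOT level-free (its rate degrades with the block side — recorded in the header of
`Support/SliceCovariantModel`).  The chain proves the level-free statement for the Support-typed ONE-REGION covariant scalar operator
`S_U = scalarOp n M a′ R T = D_RᴴD_R + a′·n^d·Q′(U)ᴴQ′(U)` of `Support/ScalarCovariantLaplacian` (p208899) on `Tor (fine n M) × o` (fine
torus of side `n·M_μ`, `n = L^j = η⁻¹`, colour index `o`; transporters `R_μ(x)` and site transports `T(x)` are DATA).

THIS FILE (file 2): the **row defects** `Beta.DeltaACombesThomas.ctRowDefect A κ ρ e = Σ_{e′} ‖A e e′‖·(cosh(κ(ρ e − ρ e′)) − 1)` (pairwise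
`cosh` weights, the currency of `combesThomas_pairwise_inv`) of the pieces of `S_U` for the SITE weight `siteW ρ₀ (x, α) = ρ₀ x` of file 1,
`ρ₀` being `ℓ`-Lipschitz along fine bonds and oscillating by `≤ Λ` on blocks:
 * site-diagonal kernels cost nothing (`ctRowDefect_siteDiag_eq_zero`, `ctRowDefect_siteMul_eq_zero`, `ctRowDefect_one_eq_zero`);
 * the transported shift `siteMul v·(S_μ ⊗ 1)` (entries `[x′ = x + e_μ]·v(x)_{αα′}`, `siteMul_shift_apply`) and its adjoint cost
   `card o·sup‖v‖·(cosh κℓ − 1)` (`ctRowDefect_siteMul_shift_le`, `ctRowDefect_siteMul_shift_adj_le`); with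
   `scovD_μᴴscovD_μ = n²·((sRS)ᴴ(sRS) − (sRS)ᴴ − sRS + 1)` (`scovD_sq_eq`; `(sRS)ᴴ(sRS)` site-diagonal by
   `ScalarCovariantLaplacian.siteMul_shiftS_sq`) and `‖R_μ(x)‖ ≤ 1 + α/n` (`norm_R_le`):
   **`ctRowDefect_covLapS_le`**: `defect(D_RᴴD_R) ≤ 2d·card o·(n² + nα)·(cosh κℓ − 1)`;
 * the mass term: `Π′(x,x′) = n^{−d}[same block]` (`PiS_apply`), entries `Π′(x,x′)·((T x)ᴴT x′)_{αα′}` (`massTerm_apply`), a block has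
   `n^d` sites (`sum_ite_blockOf_eq`), whence **`ctRowDefect_massTerm_le`**: `≤ card o·(1+τ)²·(cosh κΛ − 1)`;
 * **`ctRowDefect_scalarOp_le`** (general `ℓ`, `Λ`) and, at the block scale `ℓ = 1/n`, `Λ = 1`, **`ctRowDefect_scalarOp_le_uniform`**:
   `defect(S_U)(e) ≤ Jcov (card o) d a′ α τ κ` — via `n²(cosh(κ/n) − 1) ≤ (κ²/2)e^{κ²/2}` (`sq_mul_cosh_div_sub_one_le`), free of `n` and of
   the torus.

HONEST FRAMING (T4-DAG p. 1).  MODEL level: one region (no `Λ_j`, no Dirichlet holes), GLOBAL small field (`α`, `τ` are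
hypotheses on the data `R`, `T`), finite torus, ℓ²-pairing ∕ matrix-entry norms (no sup-norm∕Hölder (3.43)–(3.45), no derivative
entries `∇_UG′`, `G′∇_U*` — successors), route = Combes–Thomas (OURS; print's §3 route is the random-walk expansion); constants
OURS and crude.  NOT [B9] Thm 3.1 as printed; nothing printed is a hypothesis; no `def … : Prop` fact; spine 0/9 unchanged; NOT
infinite volume ∕ mass gap ∕ Clay.  HONEST DEPENDENCY: continuum YM on T⁴ ⇐ BetaPertH ∧ nine spine estimates (0/9 proved);
BetaPertH ⇐ (D1) ∧ (D4) ∧ CAP+tail; G-an2-4 gates asym, D1 and NE2/3/4.  ABSOLUTE RULE kept; no `sorry`.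
-/

noncomputable section

open scoped BigOperators ComplexConjugate Matrix Matrix.Norms.L2Operator Kronecker ComplexOrder

namespace Summit.QuantumFields.BalabanUV.T4Continuum.ScalarCovariantCTDefects

open Literature.MathematicalPhysics.QuantumFieldTheory.Balaban1983to89.B5Prop11Plancherel (Tor fine unitVec)
open Literature.MathematicalPhysics.QuantumFieldTheory.Balaban1983to89.B5Action121 (shiftS)
open Literature.MathematicalPhysics.QuantumFieldTheory.Balaban1983to89.B5Block118 (QsOp bpt)
open Literature.MathematicalPhysics.QuantumFieldTheory.Balaban1983to89.B5Blocks16 (blockOf blockOf_bpt bpt_bijective)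
open Literature.MathematicalPhysics.QuantumFieldTheory.Balaban1983to89.Beta.DeltaACombesThomas (ctWeight ctRowDefect ctWeight_nonneg
  ctRowDefect_add_le ctRowDefect_sub_le ctRowDefect_smul ctRowDefect_le_of_norm_le sq_mul_cosh_div_sub_one_le)
open Summit.QuantumFields.BalabanUV.T4Continuum
open Summit.QuantumFields.BalabanUV.T4Continuum.KroneckerLift
open Summit.QuantumFields.BalabanUV.T4Continuum.BlockMultiplication
open Summit.QuantumFields.BalabanUV.T4Continuum.KroneckerUnits (norm_entry_le)
open Summit.QuantumFields.BalabanUV.T4Continuum.ScalarBlockPoincare (PiS QsOp_apply_blockOf)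
open Summit.QuantumFields.BalabanUV.T4Continuum.ScalarCovariantLaplacian
open Summit.QuantumFields.BalabanUV.T4Continuum.ScalarCovariantCoercive (gram_eq_sandwich siteW Jcov)

variable {d : ℕ} {o : Type*} [Fintype o] [DecidableEq o]
variable (n : ℕ) [NeZero n] (M : Fin d → ℕ) [hM : ∀ μ, NeZero (M μ)]

variable {ρ₀ : Tor (fine n M) → ℝ} {κ : ℝ}

/-! ## §1 Site-diagonal pieces and transported shifts -/

section Shifts

omit [DecidableEq o] in
/-- a SITE-DIAGONAL kernel (`A e e′ = 0` unless `e.1 = e′.1`) has zero row defect for a site weight. [folklore] -/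
theorem ctRowDefect_siteDiag_eq_zero (A : Matrix (Tor (fine n M) × o) (Tor (fine n M) × o) ℂ)
    (hA : ∀ e e', e.1 ≠ e'.1 → A e e' = 0) (κ : ℝ) (ρ₀ : Tor (fine n M) → ℝ) (e : Tor (fine n M) × o) :
    ctRowDefect A κ (siteW n M ρ₀) e = 0 := by
  unfold ctRowDefect
  refine Finset.sum_eq_zero fun e' _ => ?_
  by_cases h : e.1 = e'.1
  · have : ctWeight κ (siteW n M ρ₀ (o := o)) e e' = 0 := by simp [ctWeight, siteW, h]
    rw [this, mul_zero]
  · rw [hA e e' h, norm_zero, zero_mul]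

omit [DecidableEq o] in
/-- `siteMul z` is site-diagonal: zero row defect. [folklore] -/
theorem ctRowDefect_siteMul_eq_zero (z : Tor (fine n M) → Matrix o o ℂ) (κ : ℝ) (ρ₀ : Tor (fine n M) → ℝ) (e : Tor (fine n M) × o) :
    ctRowDefect (siteMul z) κ (siteW n M ρ₀) e = 0 :=
  ctRowDefect_siteDiag_eq_zero n M _ (fun e e' h => by rw [siteMul_apply, if_neg h]) κ ρ₀ e

/-- the identity is site-diagonal: zero row defect. [folklore] -/
theorem ctRowDefect_one_eq_zero (κ : ℝ) (ρ₀ : Tor (fine n M) → ℝ) (e : Tor (fine n M) × o) :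
    ctRowDefect (1 : Matrix (Tor (fine n M) × o) (Tor (fine n M) × o) ℂ) κ (siteW n M ρ₀) e = 0 :=
  ctRowDefect_siteDiag_eq_zero n M _ (fun _ _ h => Matrix.one_apply_ne fun hee => h (congrArg Prod.fst hee)) κ ρ₀ e

/-- the weight of a pair at weight-distance `≤ ℓ` is `≤ cosh κℓ − 1`. [folklore] -/
theorem ctWeight_le_of_abs_le {ι : Type*} (κ : ℝ) (ρ : ι → ℝ) {e e' : ι} {ℓ : ℝ} (h : |ρ e - ρ e'| ≤ ℓ) :
    ctWeight κ ρ e e' ≤ Real.cosh (κ * ℓ) - 1 := by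
  unfold ctWeight
  have : Real.cosh (κ * (ρ e - ρ e')) ≤ Real.cosh (κ * ℓ) := by
    rw [Real.cosh_le_cosh, abs_mul, abs_mul]
    exact mul_le_mul_of_nonneg_left (h.trans (le_abs_self ℓ)) (abs_nonneg κ)
  linarith

/-- entries of the transported shift: `(siteMul v·(S_μ ⊗ 1))((x,α),(x′,α′)) = [x′ = x + e_μ]·v(x)_{αα′}`. [folklore] -/
theorem siteMul_shift_apply (v : Tor (fine n M) → Matrix o o ℂ) (μ : Fin d) (e e' : Tor (fine n M) × o) :
    (siteMul v * shiftS (fine n M) μ ⊗ₖ (1 : Matrix o o ℂ)) e e' = if e'.1 = e.1 + unitVec (fine n M) μ then v e.1 e.2 e'.2 else 0 := by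
  rw [siteMul_mul_kron_apply, shiftS]
  split_ifs <;> simp

/-- **row defect of the transported shift**: if `ρ₀` is `ℓ`-Lipschitz along fine bonds and `‖v(x)‖ ≤ V`, then
`defect(siteMul v·(S_μ ⊗ 1))(x, α) ≤ card o·V·(cosh κℓ − 1)`. [folklore] -/
theorem ctRowDefect_siteMul_shift_le (v : Tor (fine n M) → Matrix o o ℂ) (μ : Fin d) {ℓ V : ℝ} (hV : 0 ≤ V)
    (hlip : ∀ x ν, |ρ₀ (x + unitVec (fine n M) ν) - ρ₀ x| ≤ ℓ) (hv : ∀ x, ‖v x‖ ≤ V) (e : Tor (fine n M) × o) :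
    ctRowDefect (siteMul v * shiftS (fine n M) μ ⊗ₖ (1 : Matrix o o ℂ)) κ (siteW n M ρ₀) e
      ≤ Fintype.card o * V * (Real.cosh (κ * ℓ) - 1) := by
  have hw0 : 0 ≤ Real.cosh (κ * ℓ) - 1 := by linarith [Real.one_le_cosh (κ * ℓ)]
  calc ctRowDefect (siteMul v * shiftS (fine n M) μ ⊗ₖ (1 : Matrix o o ℂ)) κ (siteW n M ρ₀) e
      ≤ ∑ e' : Tor (fine n M) × o, (if e'.1 = e.1 + unitVec (fine n M) μ then V else 0) * ctWeight κ (siteW n M ρ₀) e e' := by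
        refine ctRowDefect_le_of_norm_le (siteMul v * shiftS (fine n M) μ ⊗ₖ (1 : Matrix o o ℂ))
          (fun e₁ e' => if e'.1 = e₁.1 + unitVec (fine n M) μ then V else 0) κ (siteW n M ρ₀) e fun e' => ?_
        rw [siteMul_shift_apply]
        split_ifs with h
        · exact (norm_entry_le _ _ _).trans (hv e.1)
        · rw [norm_zero]
    _ = ∑ α' : o, V * ctWeight κ (siteW n M ρ₀) e (e.1 + unitVec (fine n M) μ, α') := by
        rw [Fintype.sum_prod_type, Finset.sum_eq_single (e.1 + unitVec (fine n M) μ)]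
        · simp
        · intro x _ hx; simp [hx]
        · intro h; exact absurd (Finset.mem_univ _) h
    _ ≤ ∑ _α' : o, V * (Real.cosh (κ * ℓ) - 1) := by
        refine Finset.sum_le_sum fun α' _ => mul_le_mul_of_nonneg_left (ctWeight_le_of_abs_le κ _ ?_) hV
        simp only [siteW]
        rw [abs_sub_comm]; exact hlip e.1 μ
    _ = Fintype.card o * V * (Real.cosh (κ * ℓ) - 1) := by rw [Finset.sum_const, Finset.card_univ, nsmul_eq_mul]; ring

/-- **row defect of the adjoint transported shift**: `defect((siteMul v·(S_μ ⊗ 1))ᴴ)(x, α) ≤ card o·V·(cosh κℓ − 1)` (its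
entries sit at `x′ = x − e_μ`). [folklore] -/
theorem ctRowDefect_siteMul_shift_adj_le (v : Tor (fine n M) → Matrix o o ℂ) (μ : Fin d) {ℓ V : ℝ} (hV : 0 ≤ V)
    (hlip : ∀ x ν, |ρ₀ (x + unitVec (fine n M) ν) - ρ₀ x| ≤ ℓ) (hv : ∀ x, ‖v x‖ ≤ V) (e : Tor (fine n M) × o) :
    ctRowDefect (siteMul v * shiftS (fine n M) μ ⊗ₖ (1 : Matrix o o ℂ))ᴴ κ (siteW n M ρ₀) e
      ≤ Fintype.card o * V * (Real.cosh (κ * ℓ) - 1) := by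
  have hw0 : 0 ≤ Real.cosh (κ * ℓ) - 1 := by linarith [Real.one_le_cosh (κ * ℓ)]
  calc ctRowDefect (siteMul v * shiftS (fine n M) μ ⊗ₖ (1 : Matrix o o ℂ))ᴴ κ (siteW n M ρ₀) e
      ≤ ∑ e' : Tor (fine n M) × o, (if e'.1 = e.1 - unitVec (fine n M) μ then V else 0) * ctWeight κ (siteW n M ρ₀) e e' := by
        refine ctRowDefect_le_of_norm_le (siteMul v * shiftS (fine n M) μ ⊗ₖ (1 : Matrix o o ℂ))ᴴ
          (fun e₁ e' => if e'.1 = e₁.1 - unitVec (fine n M) μ then V else 0) κ (siteW n M ρ₀) e fun e' => ?_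
        rw [Matrix.conjTranspose_apply, norm_star, siteMul_shift_apply]
        by_cases h : e'.1 = e.1 - unitVec (fine n M) μ
        · rw [if_pos h]
          split_ifs
          · exact (norm_entry_le _ _ _).trans (hv e'.1)
          · rw [norm_zero]; exact hV
        · rw [if_neg h]
          have h' : ¬ e.1 = e'.1 + unitVec (fine n M) μ := fun h' => h (by rw [h', add_sub_cancel_right])
          rw [if_neg h', norm_zero]
    _ = ∑ α' : o, V * ctWeight κ (siteW n M ρ₀) e (e.1 - unitVec (fine n M) μ, α') := by
        rw [Fintype.sum_prod_type, Finset.sum_eq_single (e.1 - unitVec (fine n M) μ)]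
        · simp
        · intro x _ hx; simp [hx]
        · intro h; exact absurd (Finset.mem_univ _) h
    _ ≤ ∑ _α' : o, V * (Real.cosh (κ * ℓ) - 1) := by
        refine Finset.sum_le_sum fun α' _ => mul_le_mul_of_nonneg_left (ctWeight_le_of_abs_le κ _ ?_) hV
        simp only [siteW]
        have h := hlip (e.1 - unitVec (fine n M) μ) μ
        rwa [sub_add_cancel] at h
    _ = Fintype.card o * V * (Real.cosh (κ * ℓ) - 1) := by rw [Finset.sum_const, Finset.card_univ, nsmul_eq_mul]; ring

omit hM in
/-- the size of the transporters from the size of the connection: `‖R_μ(x)‖ ≤ 1 + α/n`. [folklore] -/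
theorem norm_R_le {R : Fin d → (Tor (fine n M) → Matrix o o ℂ)} {α : ℝ}
    (hR : ∀ μ x, ‖connS (fine n M) ((n : ℕ) : ℂ) R μ x‖ ≤ α) (μ : Fin d) (x : Tor (fine n M)) : ‖R μ x‖ ≤ 1 + α / n := by
  have hn0 : (0 : ℝ) < n := by exact_mod_cast Nat.pos_of_ne_zero (NeZero.ne n)
  have h1 : ‖(1 : Matrix o o ℂ)‖ ≤ 1 := by rw [Matrix.cstar_norm_def, map_one]; exact ContinuousLinearMap.norm_id_le
  have h2 : ‖R μ x - 1‖ ≤ α / n := by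
    have h := hR μ x
    rw [connS, norm_smul, Complex.norm_natCast] at h
    rw [le_div_iff₀ hn0, mul_comm]; exact h
  calc ‖R μ x‖ = ‖(R μ x - 1) + 1‖ := by rw [sub_add_cancel]
    _ ≤ ‖R μ x - 1‖ + ‖(1 : Matrix o o ℂ)‖ := norm_add_le _ _
    _ ≤ α / n + 1 := add_le_add h2 h1
    _ = 1 + α / n := add_comm _ _

/-- per direction: `scovD_μᴴ scovD_μ = n²·((sRS)ᴴ(sRS) − (sRS)ᴴ − sRS + 1)`, `sRS = siteMul(R_μ)·(S_μ ⊗ 1)`. [folklore] -/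
theorem scovD_sq_eq (R : Fin d → (Tor (fine n M) → Matrix o o ℂ)) (μ : Fin d) :
    (scovD (fine n M) ((n : ℕ) : ℂ) R μ)ᴴ * scovD (fine n M) ((n : ℕ) : ℂ) R μ
      = (((n : ℕ) : ℂ) ^ 2) • ((siteMul (R μ) * shiftS (fine n M) μ ⊗ₖ (1 : Matrix o o ℂ))ᴴ * (siteMul (R μ) * shiftS (fine n M) μ ⊗ₖ (1 : Matrix o o ℂ))
          - (siteMul (R μ) * shiftS (fine n M) μ ⊗ₖ (1 : Matrix o o ℂ))ᴴ - siteMul (R μ) * shiftS (fine n M) μ ⊗ₖ (1 : Matrix o o ℂ) + 1) := by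
  set X := siteMul (R μ) * shiftS (fine n M) μ ⊗ₖ (1 : Matrix o o ℂ) with hX
  rw [scovD, ← hX, Matrix.conjTranspose_smul, AbelianCovariantLaplacian.star_natCast_complex, Matrix.smul_mul, Matrix.mul_smul,
    smul_smul, ← pow_two, Matrix.conjTranspose_sub, Matrix.conjTranspose_one]
  congr 1
  simp only [Matrix.sub_mul, Matrix.mul_sub, Matrix.one_mul, Matrix.mul_one]
  abel

/-- **row defect of `D_RᴴD_R`**: `≤ 2d·card o·(n² + nα)·(cosh κℓ − 1)` (the site-diagonal pieces cost nothing; the `2d` transported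
shifts cost `card o·‖R‖` each). [folklore] -/
theorem ctRowDefect_covLapS_le {R : Fin d → (Tor (fine n M) → Matrix o o ℂ)} {α ℓ : ℝ} (hα : 0 ≤ α)
    (hR : ∀ μ x, ‖connS (fine n M) ((n : ℕ) : ℂ) R μ x‖ ≤ α) (hlip : ∀ x ν, |ρ₀ (x + unitVec (fine n M) ν) - ρ₀ x| ≤ ℓ)
    (e : Tor (fine n M) × o) :
    ctRowDefect (covLapS (fine n M) ((n : ℕ) : ℂ) R) κ (siteW n M ρ₀) e
      ≤ 2 * d * Fintype.card o * ((n : ℝ) ^ 2 + n * α) * (Real.cosh (κ * ℓ) - 1) := by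
  have hn0 : (0 : ℝ) < n := by exact_mod_cast Nat.pos_of_ne_zero (NeZero.ne n)
  have hw0 : 0 ≤ Real.cosh (κ * ℓ) - 1 := by linarith [Real.one_le_cosh (κ * ℓ)]
  have hV : 0 ≤ 1 + α / n := by positivity
  have hRn : ∀ μ x, ‖R μ x‖ ≤ 1 + α / n := norm_R_le n M hR
  -- per direction
  have hdir : ∀ μ : Fin d, ctRowDefect ((scovD (fine n M) ((n : ℕ) : ℂ) R μ)ᴴ * scovD (fine n M) ((n : ℕ) : ℂ) R μ) κ (siteW n M ρ₀) e
      ≤ (n : ℝ) ^ 2 * (2 * (Fintype.card o * (1 + α / n) * (Real.cosh (κ * ℓ) - 1))) := by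
    intro μ
    set X := siteMul (R μ) * shiftS (fine n M) μ ⊗ₖ (1 : Matrix o o ℂ) with hX
    have hsq : ctRowDefect (Xᴴ * X) κ (siteW n M ρ₀) e = 0 := by
      rw [hX, siteMul_shiftS_sq]; exact ctRowDefect_siteMul_eq_zero n M _ κ ρ₀ e
    have h1 : ctRowDefect Xᴴ κ (siteW n M ρ₀) e ≤ Fintype.card o * (1 + α / n) * (Real.cosh (κ * ℓ) - 1) :=
      ctRowDefect_siteMul_shift_adj_le n M (R μ) μ hV hlip (hRn μ) e
    have h2 : ctRowDefect X κ (siteW n M ρ₀) e ≤ Fintype.card o * (1 + α / n) * (Real.cosh (κ * ℓ) - 1) :=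
      ctRowDefect_siteMul_shift_le n M (R μ) μ hV hlip (hRn μ) e
    have hnorm : ‖(((n : ℕ) : ℂ) ^ 2)‖ = (n : ℝ) ^ 2 := by rw [norm_pow, Complex.norm_natCast]
    rw [scovD_sq_eq, ← hX, ctRowDefect_smul, hnorm]
    refine mul_le_mul_of_nonneg_left ?_ (by positivity)
    calc ctRowDefect (Xᴴ * X - Xᴴ - X + 1) κ (siteW n M ρ₀) e
        ≤ ctRowDefect (Xᴴ * X - Xᴴ - X) κ (siteW n M ρ₀) e + ctRowDefect (1 : Matrix _ _ ℂ) κ (siteW n M ρ₀) e := ctRowDefect_add_le _ _ _ _ _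
      _ ≤ (ctRowDefect (Xᴴ * X - Xᴴ) κ (siteW n M ρ₀) e + ctRowDefect X κ (siteW n M ρ₀) e) + 0 := by
          rw [ctRowDefect_one_eq_zero]; exact add_le_add (ctRowDefect_sub_le _ _ _ _ _) le_rfl
      _ ≤ (ctRowDefect (Xᴴ * X) κ (siteW n M ρ₀) e + ctRowDefect Xᴴ κ (siteW n M ρ₀) e) + ctRowDefect X κ (siteW n M ρ₀) e + 0 := by
          gcongr; exact ctRowDefect_sub_le _ _ _ _ _
      _ ≤ 2 * (Fintype.card o * (1 + α / n) * (Real.cosh (κ * ℓ) - 1)) := by rw [hsq]; linarith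
  -- sum over directions
  have hsum : ctRowDefect (covLapS (fine n M) ((n : ℕ) : ℂ) R) κ (siteW n M ρ₀) e
      ≤ ∑ μ : Fin d, ctRowDefect ((scovD (fine n M) ((n : ℕ) : ℂ) R μ)ᴴ * scovD (fine n M) ((n : ℕ) : ℂ) R μ) κ (siteW n M ρ₀) e := by
    rw [covLapS]
    induction (Finset.univ : Finset (Fin d)) using Finset.induction_on with
    | empty =>
      rw [Finset.sum_empty, Finset.sum_empty]
      exact le_of_eq (ctRowDefect_siteDiag_eq_zero n M _ (fun _ _ _ => rfl) κ ρ₀ e)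
    | @insert μ s hμ ih =>
      rw [Finset.sum_insert hμ, Finset.sum_insert hμ]
      exact (ctRowDefect_add_le _ _ _ _ _).trans (add_le_add le_rfl ih)
  refine hsum.trans ((Finset.sum_le_sum fun μ _ => hdir μ).trans (le_of_eq ?_))
  rw [Finset.sum_const, Finset.card_univ, Fintype.card_fin, nsmul_eq_mul]
  have e1 : (n : ℝ) ^ 2 * (1 + α / n) = (n : ℝ) ^ 2 + n * α := by field_simp
  rw [← e1]; ring

end Shifts

/-! ## §2 The mass term -/

section Mass

/-- the entries of `Π′`: `Π′(x, x′) = n^{−d}·[x, x′ in the same block]`. [folklore] -/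
theorem PiS_apply (x x' : Tor (fine n M)) :
    PiS n M x x' = if blockOf n M x = blockOf n M x' then 1 / ((n : ℕ) : ℂ) ^ d else 0 := by
  have hn : (((n : ℕ) : ℂ) ^ d) ≠ 0 := pow_ne_zero _ (by exact_mod_cast NeZero.ne n)
  have hstar : ∀ y, star (QsOp n M y x) = QsOp n M y x := fun y => by
    rw [QsOp_apply_blockOf]; split_ifs <;> simp
  rw [PiS, Matrix.smul_apply, Matrix.mul_apply, Finset.sum_eq_single (blockOf n M x), Matrix.conjTranspose_apply, hstar,
    QsOp_apply_blockOf, QsOp_apply_blockOf, if_pos rfl, smul_eq_mul]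
  · by_cases h : blockOf n M x = blockOf n M x'
    · rw [if_pos h.symm, if_pos h, one_div, ← mul_assoc, mul_inv_cancel₀ hn, one_mul]
    · rw [if_neg (Ne.symm h), if_neg h, mul_zero, mul_zero]
  · intro y _ hy
    rw [Matrix.conjTranspose_apply, hstar, QsOp_apply_blockOf, if_neg (Ne.symm hy), zero_mul]
  · intro h; exact absurd (Finset.mem_univ _) h

/-- **entries of the mass term**: `(siteMul(Tᴴ)·(Π′ ⊗ 1)·siteMul T)((x,α),(x′,α′)) = Π′(x,x′)·((T x)ᴴ·T x′)_{αα′}`. [folklore] -/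
theorem massTerm_apply (T : Tor (fine n M) → Matrix o o ℂ) (e e' : Tor (fine n M) × o) :
    (siteMul (fun x => (T x)ᴴ) * (PiS n M ⊗ₖ (1 : Matrix o o ℂ)) * siteMul T) e e' = PiS n M e.1 e'.1 * ((T e.1)ᴴ * T e'.1) e.2 e'.2 := by
  rw [Matrix.mul_apply, Fintype.sum_prod_type, Finset.sum_eq_single e'.1]
  · have hterm : ∀ β : o, (siteMul (fun x => (T x)ᴴ) * PiS n M ⊗ₖ (1 : Matrix o o ℂ)) e (e'.1, β) * siteMul T (e'.1, β) e'
        = PiS n M e.1 e'.1 * ((T e.1)ᴴ e.2 β * T e'.1 β e'.2) := by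
      intro β
      rw [siteMul_mul_kron_apply, siteMul_apply, if_pos rfl]; ring
    rw [Finset.sum_congr rfl fun β _ => hterm β, ← Finset.mul_sum, Matrix.mul_apply]
  · intro y _ hy
    exact Finset.sum_eq_zero fun β _ => by rw [siteMul_apply, if_neg hy, mul_zero]
  · intro h; exact absurd (Finset.mem_univ _) h

/-- the number of fine sites in a block is `n^d`: `Σ_{x′} [blockOf x′ = y]·c = n^d·c`. [folklore] -/
theorem sum_ite_blockOf_eq (y : Tor M) (c : ℝ) :
    ∑ x' : Tor (fine n M), (if blockOf n M x' = y then c else 0) = (n : ℝ) ^ d * c := by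
  have h := (bpt_bijective n M).sum_comp (fun x' => if blockOf n M x' = y then c else 0)
  rw [← h, Fintype.sum_prod_type, Finset.sum_eq_single y]
  · simp only [blockOf_bpt, if_true, Finset.sum_const, Finset.card_univ, Fintype.card_pi, Fintype.card_fin, Finset.prod_const,
      nsmul_eq_mul, Nat.cast_pow]
  · intro y' _ hy'
    exact Finset.sum_eq_zero fun j _ => by rw [blockOf_bpt, if_neg hy']
  · intro h; exact absurd (Finset.mem_univ _) h

/-- **row defect of the mass term**: if `ρ₀` oscillates by `≤ Λ` on blocks and `‖T(x) − 1‖ ≤ τ`, then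
`defect(siteMul(Tᴴ)·(Π′ ⊗ 1)·siteMul T)(x, α) ≤ card o·(1+τ)²·(cosh κΛ − 1)` (the `n^{−d}` of `Π′` against the `n^d` sites of the
block). [folklore] -/
theorem ctRowDefect_massTerm_le {T : Tor (fine n M) → Matrix o o ℂ} {τ Λ : ℝ} (hτ : 0 ≤ τ) (hT : ∀ x, ‖T x - 1‖ ≤ τ)
    (hosc : ∀ x x', blockOf n M x = blockOf n M x' → |ρ₀ x - ρ₀ x'| ≤ Λ) (e : Tor (fine n M) × o) :
    ctRowDefect (siteMul (fun x => (T x)ᴴ) * (PiS n M ⊗ₖ (1 : Matrix o o ℂ)) * siteMul T) κ (siteW n M ρ₀) e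
      ≤ Fintype.card o * (1 + τ) ^ 2 * (Real.cosh (κ * Λ) - 1) := by
  have hn0 : (0 : ℝ) < (n : ℝ) ^ d := pow_pos (by exact_mod_cast Nat.pos_of_ne_zero (NeZero.ne n)) d
  have hw0 : 0 ≤ Real.cosh (κ * Λ) - 1 := by linarith [Real.one_le_cosh (κ * Λ)]
  have h1 : ‖(1 : Matrix o o ℂ)‖ ≤ 1 := by rw [Matrix.cstar_norm_def, map_one]; exact ContinuousLinearMap.norm_id_le
  have hTn : ∀ x, ‖T x‖ ≤ 1 + τ := fun x =>
    calc ‖T x‖ = ‖(T x - 1) + 1‖ := by rw [sub_add_cancel]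
      _ ≤ τ + 1 := (norm_add_le _ _).trans (add_le_add (hT x) h1)
      _ = 1 + τ := add_comm _ _
  have hprod : ∀ x x' (a b : o), ‖((T x)ᴴ * T x') a b‖ ≤ (1 + τ) ^ 2 := fun x x' a b =>
    calc ‖((T x)ᴴ * T x') a b‖ ≤ ‖(T x)ᴴ * T x'‖ := norm_entry_le _ _ _
      _ ≤ ‖(T x)ᴴ‖ * ‖T x'‖ := Matrix.l2_opNorm_mul _ _
      _ ≤ (1 + τ) * (1 + τ) := mul_le_mul (by rw [Matrix.l2_opNorm_conjTranspose]; exact hTn x) (hTn x') (norm_nonneg _) (by positivity)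
      _ = (1 + τ) ^ 2 := by ring
  set K : ℝ := ((n : ℝ) ^ d)⁻¹ * (1 + τ) ^ 2 with hK
  calc ctRowDefect (siteMul (fun x => (T x)ᴴ) * (PiS n M ⊗ₖ (1 : Matrix o o ℂ)) * siteMul T) κ (siteW n M ρ₀) e
      ≤ ∑ e' : Tor (fine n M) × o, (if blockOf n M e'.1 = blockOf n M e.1 then K else 0) * ctWeight κ (siteW n M ρ₀) e e' := by
        refine ctRowDefect_le_of_norm_le (siteMul (fun x => (T x)ᴴ) * (PiS n M ⊗ₖ (1 : Matrix o o ℂ)) * siteMul T)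
          (fun e₁ e' => if blockOf n M e'.1 = blockOf n M e₁.1 then K else 0) κ (siteW n M ρ₀) e fun e' => ?_
        rw [massTerm_apply, PiS_apply]
        by_cases h : blockOf n M e.1 = blockOf n M e'.1
        · rw [if_pos h, if_pos h.symm, norm_mul, hK]
          refine mul_le_mul ?_ (hprod _ _ _ _) (norm_nonneg _) (by positivity)
          rw [norm_div, norm_one, norm_pow, Complex.norm_natCast, one_div]
        · rw [if_neg h, if_neg (Ne.symm h), zero_mul, norm_zero]
    _ ≤ ∑ e' : Tor (fine n M) × o, (if blockOf n M e'.1 = blockOf n M e.1 then K else 0) * (Real.cosh (κ * Λ) - 1) := by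
        refine Finset.sum_le_sum fun e' _ => ?_
        by_cases h : blockOf n M e'.1 = blockOf n M e.1
        · rw [if_pos h]
          exact mul_le_mul_of_nonneg_left (ctWeight_le_of_abs_le κ _ (hosc _ _ h.symm)) (by positivity)
        · rw [if_neg h, zero_mul, zero_mul]
    _ = (∑ e' : Tor (fine n M) × o, (if blockOf n M e'.1 = blockOf n M e.1 then K else 0)) * (Real.cosh (κ * Λ) - 1) := by
        rw [Finset.sum_mul]
    _ = Fintype.card o * ((n : ℝ) ^ d * K) * (Real.cosh (κ * Λ) - 1) := by
        congr 1
        have hsum : (∑ e' : Tor (fine n M) × o, (if blockOf n M e'.1 = blockOf n M e.1 then K else 0))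
            = ∑ x' : Tor (fine n M), ∑ _α' : o, (if blockOf n M x' = blockOf n M e.1 then K else 0) := Fintype.sum_prod_type _
        rw [hsum]
        simp only [Finset.sum_const, Finset.card_univ, nsmul_eq_mul]
        rw [← Finset.mul_sum, sum_ite_blockOf_eq n M (blockOf n M e.1) K]
    _ = Fintype.card o * (1 + τ) ^ 2 * (Real.cosh (κ * Λ) - 1) := by rw [hK]; field_simp

end Mass

/-! ## §3 Assembly: the row defect of `S_U`, general and at the block scale -/

section Assembly

/-- **ROW DEFECT OF `S_U`** for a site weight `ℓ`-Lipschitz along fine bonds and oscillating by `≤ Λ` on blocks: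
`defect(S_U)(e) ≤ card o·(2d(n² + nα)(cosh κℓ − 1) + a′(1+τ)²(cosh κΛ − 1))`. [folklore] -/
theorem ctRowDefect_scalarOp_le {a' : ℝ} (ha' : 0 ≤ a') {R : Fin d → (Tor (fine n M) → Matrix o o ℂ)} {T : Tor (fine n M) → Matrix o o ℂ}
    {α τ ℓ Λ : ℝ} (hα : 0 ≤ α) (hτ : 0 ≤ τ) (hR : ∀ μ x, ‖connS (fine n M) ((n : ℕ) : ℂ) R μ x‖ ≤ α) (hT : ∀ x, ‖T x - 1‖ ≤ τ)
    (hlip : ∀ x ν, |ρ₀ (x + unitVec (fine n M) ν) - ρ₀ x| ≤ ℓ) (hosc : ∀ x x', blockOf n M x = blockOf n M x' → |ρ₀ x - ρ₀ x'| ≤ Λ)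
    (e : Tor (fine n M) × o) :
    ctRowDefect (scalarOp n M a' R T) κ (siteW n M ρ₀) e
      ≤ Fintype.card o * (2 * d * ((n : ℝ) ^ 2 + n * α) * (Real.cosh (κ * ℓ) - 1) + a' * (1 + τ) ^ 2 * (Real.cosh (κ * Λ) - 1)) := by
  rw [scalarOp, gram_eq_sandwich]
  refine (ctRowDefect_add_le _ _ _ _ _).trans ?_
  rw [ctRowDefect_smul, Complex.norm_real, Real.norm_of_nonneg ha']
  have h1 := ctRowDefect_covLapS_le n M (κ := κ) hα hR hlip e
  have h2 := mul_le_mul_of_nonneg_left (ctRowDefect_massTerm_le n M (κ := κ) hτ hT hosc e) ha'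
  calc _ ≤ 2 * d * Fintype.card o * ((n : ℝ) ^ 2 + n * α) * (Real.cosh (κ * ℓ) - 1)
        + a' * (Fintype.card o * (1 + τ) ^ 2 * (Real.cosh (κ * Λ) - 1)) := add_le_add h1 h2
    _ = _ := by ring

/-- **ROW DEFECT OF `S_U` AT THE BLOCK SCALE, UNIFORM IN `n`**: for a site weight `1/n`-Lipschitz along fine bonds and oscillating by
`≤ 1` on blocks, `defect(S_U)(e) ≤ Jcov (card o) d a′ α τ κ` — free of `n = L^j` and of the torus
(`n²(cosh(κ/n) − 1) ≤ (κ²/2)e^{κ²/2}`). [folklore] -/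
theorem ctRowDefect_scalarOp_le_uniform {a' : ℝ} (ha' : 0 ≤ a') {R : Fin d → (Tor (fine n M) → Matrix o o ℂ)}
    {T : Tor (fine n M) → Matrix o o ℂ} {α τ : ℝ} (hα : 0 ≤ α) (hτ : 0 ≤ τ)
    (hR : ∀ μ x, ‖connS (fine n M) ((n : ℕ) : ℂ) R μ x‖ ≤ α) (hT : ∀ x, ‖T x - 1‖ ≤ τ)
    (hlip : ∀ x ν, |ρ₀ (x + unitVec (fine n M) ν) - ρ₀ x| ≤ 1 / n) (hosc : ∀ x x', blockOf n M x = blockOf n M x' → |ρ₀ x - ρ₀ x'| ≤ 1)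
    (e : Tor (fine n M) × o) :
    ctRowDefect (scalarOp n M a' R T) κ (siteW n M ρ₀) e ≤ Jcov (Fintype.card o) d a' α τ κ := by
  have hn1 : 1 ≤ n := Nat.one_le_iff_ne_zero.mpr (NeZero.ne n)
  have hn0 : (1 : ℝ) ≤ n := by exact_mod_cast hn1
  refine (ctRowDefect_scalarOp_le n M (κ := κ) ha' hα hτ hR hT hlip hosc e).trans ?_
  have hc0 : 0 ≤ Real.cosh (κ * (1 / n)) - 1 := by linarith [Real.one_le_cosh (κ * (1 / n))]
  -- `(n² + nα)(cosh(κ/n) − 1) ≤ (1+α)·n²(cosh(κ/n) − 1) ≤ (1+α)(κ²/2)e^{κ²/2}`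
  have h1 : ((n : ℝ) ^ 2 + n * α) * (Real.cosh (κ * (1 / n)) - 1) ≤ (1 + α) * (κ ^ 2 / 2 * Real.exp (κ ^ 2 / 2)) := by
    have hle : (n : ℝ) ^ 2 + n * α ≤ (1 + α) * (n : ℝ) ^ 2 := by
      have h := mul_nonneg (mul_nonneg hα (Nat.cast_nonneg n)) (sub_nonneg.mpr hn0)
      nlinarith [h]
    have hu := sq_mul_cosh_div_sub_one_le (n := n) κ hn1
    rw [show κ * (1 / (n : ℝ)) = κ / n by ring]
    calc ((n : ℝ) ^ 2 + n * α) * (Real.cosh (κ / n) - 1) ≤ (1 + α) * (n : ℝ) ^ 2 * (Real.cosh (κ / n) - 1) :=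
          mul_le_mul_of_nonneg_right hle (by rwa [show κ * (1 / (n : ℝ)) = κ / n by ring] at hc0)
      _ = (1 + α) * ((n : ℝ) ^ 2 * (Real.cosh (κ / n) - 1)) := by ring
      _ ≤ (1 + α) * (κ ^ 2 / 2 * Real.exp (κ ^ 2 / 2)) := mul_le_mul_of_nonneg_left hu (by positivity)
  rw [mul_one, Jcov]
  refine mul_le_mul_of_nonneg_left (add_le_add ?_ le_rfl) (Nat.cast_nonneg _)
  calc 2 * (d : ℝ) * ((n : ℝ) ^ 2 + n * α) * (Real.cosh (κ * (1 / n)) - 1)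
      = 2 * d * (((n : ℝ) ^ 2 + n * α) * (Real.cosh (κ * (1 / n)) - 1)) := by ring
    _ ≤ 2 * d * ((1 + α) * (κ ^ 2 / 2 * Real.exp (κ ^ 2 / 2))) := mul_le_mul_of_nonneg_left h1 (by positivity)
    _ = d * (1 + α) * (κ ^ 2 * Real.exp (κ ^ 2 / 2)) := by ring

end Assembly

end Summit.QuantumFields.BalabanUV.T4Continuum.ScalarCovariantCTDefects

end
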